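import Mathlib
import Literature.NumberTheory.LFunctions.Zhang2022.Section15CU1Local
import HarnessLib

/-!
# Zhang (2022), §15 Lemma 15.3 / App. A p. 105: the value at `s = 1` of the repaired Euler factor
# `𝔲ᴿ₁ⱼ(q,1)` for a prime `q ∤ D`, `q ≤ D` — kernel-checked

Topic `Literature/NumberTheory/LFunctions/Zhang2022` (Landau–Siegel audit tree; verdict-neutral).
Y. Zhang, *Discrete mean estimates and the Landau–Siegel zero*, arXiv:2211.02515v1 (2022)
[Zhang2022LandauSiegel] — **an unrefereed manuscript under adjudication; nothing in this file asserts
or denies its Theorems 1–2.** ZHANG-L discharge lane (WP15), helper under the leaf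
`Typed.Section15C.Lemma153RpI` (Lemma 15.3, repaired normaliser; rows G-L4t3-1 / G-d52-1): the
per-prime VALUE hypothesis `hval` of the glue `Typed.Section15C.step15_u053R_of_local`
(`Section15CStep15u053RGlue`), i.e. the "value at `1`" half of App. A's sketch of Lemma 15.3
(p. 105, tex L5176–L5185): for a prime `q ∤ D`, `q ≤ D`,

  `𝔲ᴿ₁ⱼ(q,1) = (1 − q⁻²)²/(1 − χ(q)q⁻²) + O(α·log q/q)`.

Route (all inputs are tree theorems): the closed form of `𝔲ᴿ₁ⱼ(q,s)`
(`Lemma153Rp.frakU1FactorR_eq_poly`, at `s = 1`: `x = q⁻¹ =: u`, `w = χ(q)q^{βⱼ−1} = v·q^{−(1−βⱼ)}`)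
rearranged as `(1 − xw) + (Q−1)(2x−x²−xw) + (R−1)(2w−w²−xw)` (using `P − 1 = (Q−1) + (R−1)`,
`Lemma153Rp.lam_mul_calM1Factor_prime_prime_sub`); the three local ratios `Q − 1 = λ₁(q)B′/D_F`,
`R − 1 = ((λ₁(q)−1) + λ₁(q)E)/D_F` with `D_F = 1 + λ₁(q)·sumA6(q, 1−βⱼ)`
(`Lemma153Rp.calM1Factor_one_prime_sub`, `lam_mul_calM1Factor_prime_one_sub`,
`AppendixALocal.calM1Factor_one_one_eq`); and the `β`-perturbation estimates of the proof of
Lemma 15.2 in App. A (`AppendixALocal.stepA_u026_holds`, `stepA_u027_holds`, `local_estimates`,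
`norm_kappa₁_prime_pow_sub_one_le`, `norm_kappaTildeOneLocal_sub_le`) at `s = 1 − βⱼ`
(`|βⱼ| < 5α`, `Lemma153Rp.norm_betaJ_lt`). The main term is the exact identity
`(1 − vu²) + q₀·u(2 − u − vu) + r₀·u(2v − u − vu) = (1−u²)²/(1−vu²)` (`v = ±1`) for the `β = 0`
values `q₀ = (Q−1)|₀`, `r₀ = (R−1)|₀` (`main_term_identity`).

Main result (theorems only; no new definitions, no facts): `Typed.Section15C.hval_holds` — the
`hval` binder VERBATIM (error `C·α·log q/q`), so that with an `hloc` theorem the glue route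
`lemma153RpI_of_local ∘ step15_u053R_of_local` closes `Lemma153RpI` (a second route, independent of
the direct chain `Lemma153Rp.norm_frakU1FactorR_one_sub_main_le` / `Section15CLemma153Rp`, which it
does not import).

## References

* Y. Zhang, arXiv:2211.02515v1 (2022), §15 Lemma 15.3 p. 87; App. A pp. 103–105 (proofs of
  Lemmas 15.2 and 15.3). [cite: Zhang2022LandauSiegel, App. A p. 105]
-/

noncomputable section

open Complex Real Filter Topology Finset

namespace Literature.NumberTheory.LFunctions.Zhang2022.Typed.Section15C

open Literature.NumberTheory.LFunctions.Zhang2022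
open Literature.NumberTheory.LFunctions.Zhang2022.Typed.Section15A
open Literature.NumberTheory.LFunctions.Zhang2022.Typed.Section15B

/-! ## §1. Generic estimates -/

/-- **A perturbed geometric series**: if `‖f r − c‖ ≤ r·ε` for `r ≥ 1` and `‖w‖ ≤ 3/5`, then
`Σ_{r≥1} f(r)wʳ` converges and `‖Σ_{r≥1} f(r)wʳ − c·w/(1−w)‖ ≤ 7ε‖w‖`
(`Σ_{r≥1} r tʳ = t/(1−t)² ≤ (25/4)t` for `t ≤ 3/5`). (elementary step of the proof of Lemma 15.2)
[cite: Zhang2022LandauSiegel, App. A p. 104] -/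
theorem summable_and_norm_tsum_ite_mul_pow_sub_le {f : ℕ → ℂ} {c w : ℂ} {ε : ℝ} (hε : 0 ≤ ε)
    (hw : ‖w‖ ≤ 3 / 5) (hf : ∀ r : ℕ, 1 ≤ r → ‖f r - c‖ ≤ r * ε) :
    Summable (fun r : ℕ => if r = 0 then (0 : ℂ) else f r * w ^ r) ∧
      ‖(∑' r : ℕ, if r = 0 then (0 : ℂ) else f r * w ^ r) - c * (w / (1 - w))‖ ≤ 7 * ε * ‖w‖ := by
  have hw1 : ‖w‖ < 1 := by linarith
  have hw0 : 0 ≤ ‖w‖ := norm_nonneg w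
  -- the geometric part `Σ_{r≥1} wʳ = w/(1−w)`
  have hgeom : HasSum (fun r : ℕ => if r = 0 then (0 : ℂ) else w ^ r) (w / (1 - w)) := by
    have h := (hasSum_geometric_of_norm_lt_one hw1).sub (hasSum_ite_eq 0 (1 : ℂ))
    have hne : (1 : ℂ) - w ≠ 0 := by
      intro h0
      have : ‖w‖ = 1 := by rw [← sub_eq_zero.mp h0]; simp
      linarith
    have hval : (1 - w)⁻¹ - 1 = w / (1 - w) := by field_simp; ring
    rw [hval] at h
    refine h.congr_fun fun r => ?_
    by_cases hr : r = 0
    · subst hr; simp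
    · simp [hr]
  -- the perturbation part
  set g : ℕ → ℂ := fun r => if r = 0 then (0 : ℂ) else (f r - c) * w ^ r with hg
  have hg_le : ∀ r : ℕ, ‖g r‖ ≤ ε * ((r : ℝ) * ‖w‖ ^ r) := by
    intro r
    by_cases hr : r = 0
    · subst hr; simp [hg]
    · have hr1 : 1 ≤ r := Nat.one_le_iff_ne_zero.mpr hr
      simp only [hg, hr, if_false]
      rw [norm_mul, norm_pow]
      calc ‖f r - c‖ * ‖w‖ ^ r ≤ (r * ε) * ‖w‖ ^ r := by gcongr; exact hf r hr1
        _ = ε * ((r : ℝ) * ‖w‖ ^ r) := by ring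
  have hmaj : HasSum (fun r : ℕ => ε * ((r : ℝ) * ‖w‖ ^ r)) (ε * (‖w‖ / (1 - ‖w‖) ^ 2)) :=
    (hasSum_coe_mul_geometric_of_norm_lt_one
      (by rwa [Real.norm_eq_abs, abs_of_nonneg hw0])).mul_left ε
  have hg_sum : Summable g := Summable.of_norm_bounded hmaj.summable hg_le
  have hsplit : (fun r : ℕ => if r = 0 then (0 : ℂ) else f r * w ^ r) =
      fun r : ℕ => g r + c * (if r = 0 then (0 : ℂ) else w ^ r) := by
    funext r
    by_cases hr : r = 0
    · subst hr; simp [hg]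
    · simp only [hg, hr, if_false]; ring
  have hsum : Summable (fun r : ℕ => if r = 0 then (0 : ℂ) else f r * w ^ r) := by
    rw [hsplit]; exact hg_sum.add (hgeom.summable.mul_left c)
  refine ⟨hsum, ?_⟩
  rw [hsplit, hg_sum.tsum_add (hgeom.summable.mul_left c), tsum_mul_left, hgeom.tsum_eq,
    add_sub_cancel_right]
  have ht : ‖w‖ / (1 - ‖w‖) ^ 2 ≤ 7 * ‖w‖ := by
    have hsq : (4 : ℝ) / 25 ≤ (1 - ‖w‖) ^ 2 := by nlinarith
    rw [div_le_iff₀ (by positivity)]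
    nlinarith [mul_le_mul_of_nonneg_left hsq (by positivity : (0 : ℝ) ≤ 7 * ‖w‖)]
  calc ‖∑' r : ℕ, g r‖ ≤ ε * (‖w‖ / (1 - ‖w‖) ^ 2) := tsum_of_norm_bounded hmaj hg_le
    _ ≤ ε * (7 * ‖w‖) := by gcongr
    _ = 7 * ε * ‖w‖ := by ring

/-- **Quotients of approximations**: `‖N/D − N₀/D₀‖ ≤ 2a + 2n₀b` when `‖N − N₀‖ ≤ a`,
`‖D − D₀‖ ≤ b ≤ 1/2`, `‖D₀‖ ≥ 1`, `‖N₀‖ ≤ n₀`. (elementary step) [cite: Zhang2022LandauSiegel, App. A p. 105] -/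
theorem norm_div_sub_div_le_of_approx {N N₀ Dd D₀ : ℂ} {a b n₀ : ℝ} (hN : ‖N - N₀‖ ≤ a)
    (hD : ‖Dd - D₀‖ ≤ b) (hb : b ≤ 1 / 2) (hD₀ : 1 ≤ ‖D₀‖) (hN₀ : ‖N₀‖ ≤ n₀) :
    ‖N / Dd - N₀ / D₀‖ ≤ 2 * a + 2 * n₀ * b := by
  have ha : 0 ≤ a := (norm_nonneg _).trans hN
  have hb0 : 0 ≤ b := (norm_nonneg _).trans hD
  have hn₀ : 0 ≤ n₀ := (norm_nonneg _).trans hN₀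
  have hDd : 1 / 2 ≤ ‖Dd‖ := by
    have := norm_sub_norm_le D₀ Dd
    rw [norm_sub_rev] at hD
    linarith
  have hDd0 : Dd ≠ 0 := by
    intro h; rw [h, norm_zero] at hDd; linarith
  have hD₀0 : D₀ ≠ 0 := by
    intro h; rw [h, norm_zero] at hD₀; linarith
  have key : N / Dd - N₀ / D₀ = (N - N₀) / Dd + N₀ * (D₀ - Dd) / (Dd * D₀) := by
    field_simp; ring
  rw [key]
  have h1 : ‖(N - N₀) / Dd‖ ≤ 2 * a := by
    rw [norm_div, div_le_iff₀ (by linarith)]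
    nlinarith
  have h2 : ‖N₀ * (D₀ - Dd) / (Dd * D₀)‖ ≤ 2 * n₀ * b := by
    rw [norm_div, norm_mul, norm_mul, div_le_iff₀ (by positivity), norm_sub_rev]
    have h3 : ‖N₀‖ * ‖Dd - D₀‖ ≤ n₀ * b := mul_le_mul hN₀ hD (norm_nonneg _) hn₀
    have hprod : 1 / 2 ≤ ‖Dd‖ * ‖D₀‖ := by
      have := mul_le_mul hDd hD₀ zero_le_one (norm_nonneg Dd)
      linarith
    nlinarith [mul_nonneg (mul_nonneg hn₀ hb0) (by linarith : (0 : ℝ) ≤ 2 * (‖Dd‖ * ‖D₀‖) - 1)]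
  calc _ ≤ ‖(N - N₀) / Dd‖ + ‖N₀ * (D₀ - Dd) / (Dd * D₀)‖ := norm_add_le _ _
    _ ≤ 2 * a + 2 * n₀ * b := by linarith

/-- **The main term**: for `v = ±1` and `u` real with `0 ≤ u ≤ 1/2`, with
`M = 1/(1−u) − uv(1−vu)/(1−u)²` (the `β = 0` value of `1 + λ₁(q)·sumA6`, App. A u027),
`q₀ = (1−vu)·(v/(1−u))·(u/(1−u))/M` and `r₀ = (−vu/(1−u))/M` (the `β = 0` values of `Q − 1`, `R − 1`),
`(1 − vu²) + q₀(2u − u² − vu²) + r₀(2vu − u² − vu²) = (1 − u²)²/(1 − vu²)` — the value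
`(1 − q⁻²)²/(1 − χ(q)q⁻²)` of App. A p. 105. [cite: Zhang2022LandauSiegel, App. A p. 105] -/
theorem main_term_identity {v u : ℂ} (hv : v = 1 ∨ v = -1) {uR : ℝ} (huc : u = (uR : ℂ))
    (hu0 : 0 ≤ uR) (hu : uR ≤ 1 / 2) :
    (1 - v * u ^ 2) +
        (1 - v * u) * (v / (1 - u)) * (u / (1 - u)) /
            (1 / (1 - u) - u * v * (1 - v * u) / (1 - u) ^ 2) *
          (2 * u - u ^ 2 - v * u ^ 2) +
        (-(v * u) / (1 - u)) /
            (1 / (1 - u) - u * v * (1 - v * u) / (1 - u) ^ 2) *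
          (2 * v * u - u ^ 2 - v * u ^ 2) =
      (1 - u ^ 2) ^ 2 / (1 - v * u ^ 2) := by
  subst huc
  have h1 : (1 : ℂ) - uR ≠ 0 := by
    rw [show (1 : ℂ) - uR = ((1 - uR : ℝ) : ℂ) by push_cast; ring]
    exact_mod_cast (show (1 - uR : ℝ) ≠ 0 by linarith)
  have h2 : (1 : ℂ) + uR ≠ 0 := by
    rw [show (1 : ℂ) + uR = ((1 + uR : ℝ) : ℂ) by push_cast; ring]
    exact_mod_cast (show (1 + uR : ℝ) ≠ 0 by linarith)
  have h3 : (1 : ℂ) + (uR : ℂ) ^ 2 ≠ 0 := by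
    rw [show (1 : ℂ) + (uR : ℂ) ^ 2 = ((1 + uR ^ 2 : ℝ) : ℂ) by push_cast; ring]
    exact_mod_cast (show (1 + uR ^ 2 : ℝ) ≠ 0 by positivity)
  have h4 : (1 : ℂ) - (uR : ℂ) ^ 2 ≠ 0 := by
    rw [show (1 : ℂ) - (uR : ℂ) ^ 2 = (1 - uR) * (1 + uR) by ring]
    exact mul_ne_zero h1 h2
  rcases hv with rfl | rfl
  · have h5 : (1 : ℂ) - 1 * (uR : ℂ) ≠ 0 := by rwa [one_mul]
    have h6 : (1 : ℂ) - 1 * (uR : ℂ) ^ 2 ≠ 0 := by rwa [one_mul]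
    have hM : 1 / (1 - (uR : ℂ)) - uR * 1 * (1 - 1 * uR) / (1 - (uR : ℂ)) ^ 2 = 1 := by
      field_simp
    rw [hM]
    field_simp
    ring
  · have h5 : (1 : ℂ) - (-1) * (uR : ℂ) ≠ 0 := by
      rw [show (1 : ℂ) - (-1) * (uR : ℂ) = 1 + uR by ring]; exact h2
    have h6 : (1 : ℂ) - (-1) * (uR : ℂ) ^ 2 ≠ 0 := by
      rw [show (1 : ℂ) - (-1) * (uR : ℂ) ^ 2 = 1 + (uR : ℂ) ^ 2 by ring]; exact h3
    have hM : 1 / (1 - (uR : ℂ)) - uR * (-1) * (1 - (-1) * uR) / (1 - (uR : ℂ)) ^ 2 =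
        (1 + (uR : ℂ) ^ 2) / (1 - (uR : ℂ)) ^ 2 := by
      field_simp
      ring
    rw [hM, show (1 : ℂ) - (-1) * (uR : ℂ) ^ 2 = 1 + (uR : ℂ) ^ 2 by ring,
      show (1 : ℂ) - (-1) * (uR : ℂ) = 1 + uR by ring]
    field_simp
    ring

/-- The `β = 0` denominator `M = 1/(1−u) − uv(1−vu)/(1−u)²` has modulus `≥ 1` (`= 1` for `v = 1`,
`= (1+u²)/(1−u)²` for `v = −1`; `0 ≤ u ≤ 1/2` real). [cite: Zhang2022LandauSiegel, App. A p. 104] -/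
theorem one_le_norm_mainDen {v u : ℂ} (hv : v = 1 ∨ v = -1) {uR : ℝ} (huc : u = (uR : ℂ))
    (hu0 : 0 ≤ uR) (hu : uR ≤ 1 / 2) :
    1 ≤ ‖1 / (1 - u) - u * v * (1 - v * u) / (1 - u) ^ 2‖ := by
  subst huc
  have h1 : (1 : ℂ) - uR ≠ 0 := by
    rw [show (1 : ℂ) - uR = ((1 - uR : ℝ) : ℂ) by push_cast; ring]
    exact_mod_cast (show (1 - uR : ℝ) ≠ 0 by linarith)
  rcases hv with rfl | rfl
  · have e : 1 / (1 - (uR : ℂ)) - (uR : ℂ) * 1 * (1 - 1 * uR) / (1 - (uR : ℂ)) ^ 2 = 1 := by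
      field_simp
    rw [e, norm_one]
  · have e : 1 / (1 - (uR : ℂ)) - (uR : ℂ) * (-1) * (1 - (-1) * uR) / (1 - (uR : ℂ)) ^ 2 =
        (((1 + uR ^ 2) / (1 - uR) ^ 2 : ℝ) : ℂ) := by
      have h1' : (1 - uR : ℝ) ≠ 0 := by linarith
      push_cast
      field_simp
      ring
    rw [e, Complex.norm_real, Real.norm_eq_abs, abs_of_nonneg (by positivity),
      le_div_iff₀ (by nlinarith), one_mul]
    nlinarith

/-- `‖a − b − c‖ ≤ ‖a‖ + ‖b‖ + ‖c‖`. [folklore] -/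
private theorem norm_sub_sub_le (a b c : ℂ) : ‖a - b - c‖ ≤ ‖a‖ + ‖b‖ + ‖c‖ :=
  calc ‖a - b - c‖ ≤ ‖a - b‖ + ‖c‖ := norm_sub_le _ _
    _ ≤ ‖a‖ + ‖b‖ + ‖c‖ := by gcongr; exact norm_sub_le _ _

/-- **From the closed form to the main term** (the perturbation bookkeeping of App. A p. 105 at
`s = 1`): with `u = q⁻¹` (`‖u‖ ≤ u_R ≤ 1/2`), `v = χ(q)` (`|v| ≤ 1`), `w = q^{−(1−βⱼ)}`
(`‖w − u‖ ≤ δ`, `‖w‖ ≤ 2u_R`), and `‖(Q−1) − q₀‖ ≤ a`, `‖(R−1) − r₀‖ ≤ a′` (`‖q₀‖ ≤ 3`, `‖r₀‖ ≤ 1`):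
`(1 − uvw) + (Q−1)(2u−u²−uvw) + (R−1)(2vw−w²−uvw)` differs from its value at `w = u`,
`Q−1 = q₀`, `R−1 = r₀` by at most `4u_R a + 7u_R a′ + 6δ`. [cite: Zhang2022LandauSiegel, App. A p. 105] -/
theorem norm_closedForm_sub_main_le {Q1 R1 w u v q₀ r₀ : ℂ} {uR δ a a' : ℝ}
    (huR : ‖u‖ ≤ uR) (huR2 : uR ≤ 1 / 2) (hv : ‖v‖ ≤ 1) (hwu : ‖w - u‖ ≤ δ) (hw2 : ‖w‖ ≤ 2 * uR)
    (hQ : ‖Q1 - q₀‖ ≤ a) (hR : ‖R1 - r₀‖ ≤ a') (hq₀ : ‖q₀‖ ≤ 3) (hr₀ : ‖r₀‖ ≤ 1) :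
    ‖((1 - u * v * w) + Q1 * (2 * u - u ^ 2 - u * v * w) + R1 * (2 * v * w - w ^ 2 - u * v * w)) -
        ((1 - v * u ^ 2) + q₀ * (2 * u - u ^ 2 - v * u ^ 2) + r₀ * (2 * v * u - u ^ 2 - v * u ^ 2))‖ ≤
      4 * uR * a + 7 * uR * a' + 6 * δ := by
  have hu0 : 0 ≤ uR := (norm_nonneg _).trans huR
  have hδ0 : 0 ≤ δ := (norm_nonneg _).trans hwu
  have ha0 : 0 ≤ a := (norm_nonneg _).trans hQ
  have ha0' : 0 ≤ a' := (norm_nonneg _).trans hR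
  set X : ℂ := 2 * u - u ^ 2 - u * v * w with hX
  set Y : ℂ := 2 * v * w - w ^ 2 - u * v * w with hY
  have key : ((1 - u * v * w) + Q1 * X + R1 * Y) -
      ((1 - v * u ^ 2) + q₀ * (2 * u - u ^ 2 - v * u ^ 2) + r₀ * (2 * v * u - u ^ 2 - v * u ^ 2)) =
      -(u * v * (w - u)) + (Q1 - q₀) * X + q₀ * (-(u * v * (w - u))) + (R1 - r₀) * Y +
        r₀ * ((w - u) * (2 * v - (w + u) - u * v)) := by
    rw [hX, hY]; ring
  rw [key]
  -- sizes of the weights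
  have huvw : ‖u * v * (w - u)‖ ≤ uR * δ := by
    rw [norm_mul, norm_mul]
    calc ‖u‖ * ‖v‖ * ‖w - u‖ ≤ uR * 1 * δ := by gcongr
      _ = uR * δ := by ring
  have h2u : ‖(2 : ℂ) * u‖ ≤ 2 * uR := by rw [norm_mul, Complex.norm_two]; gcongr
  have hu2 : ‖u ^ 2‖ ≤ uR * uR := by
    rw [norm_pow, sq]; exact mul_le_mul huR huR (norm_nonneg _) hu0
  have hw2' : ‖w ^ 2‖ ≤ (2 * uR) * (2 * uR) := by
    rw [norm_pow, sq]; exact mul_le_mul hw2 hw2 (norm_nonneg _) (by positivity)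
  have huvw' : ‖u * v * w‖ ≤ uR * 1 * (2 * uR) := by
    rw [norm_mul, norm_mul]; gcongr
  have h2vw : ‖(2 : ℂ) * v * w‖ ≤ 2 * 1 * (2 * uR) := by
    rw [norm_mul, norm_mul, Complex.norm_two]; gcongr
  have hXn : ‖X‖ ≤ 4 * uR := by
    calc ‖X‖ ≤ ‖(2 : ℂ) * u‖ + ‖u ^ 2‖ + ‖u * v * w‖ := by rw [hX]; exact norm_sub_sub_le _ _ _
      _ ≤ 2 * uR + uR * uR + uR * 1 * (2 * uR) := by gcongr
      _ ≤ 4 * uR := by nlinarith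
  have hYn : ‖Y‖ ≤ 7 * uR := by
    calc ‖Y‖ ≤ ‖(2 : ℂ) * v * w‖ + ‖w ^ 2‖ + ‖u * v * w‖ := by rw [hY]; exact norm_sub_sub_le _ _ _
      _ ≤ 2 * 1 * (2 * uR) + (2 * uR) * (2 * uR) + uR * 1 * (2 * uR) := by gcongr
      _ ≤ 7 * uR := by nlinarith
  have hZn : ‖2 * v - (w + u) - u * v‖ ≤ 4 := by
    have h1 : ‖(2 : ℂ) * v‖ ≤ 2 * 1 := by rw [norm_mul, Complex.norm_two]; gcongr
    have h2 : ‖w + u‖ ≤ 2 * uR + uR := (norm_add_le _ _).trans (add_le_add hw2 huR)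
    have h3 : ‖u * v‖ ≤ uR * 1 := by rw [norm_mul]; gcongr
    calc ‖2 * v - (w + u) - u * v‖ ≤ ‖(2 : ℂ) * v‖ + ‖w + u‖ + ‖u * v‖ := norm_sub_sub_le _ _ _
      _ ≤ 2 * 1 + (2 * uR + uR) + uR * 1 := by gcongr
      _ ≤ 4 := by linarith
  -- the five terms
  have t1 : ‖-(u * v * (w - u))‖ ≤ uR * δ := by rw [norm_neg]; exact huvw
  have t2 : ‖(Q1 - q₀) * X‖ ≤ a * (4 * uR) := by
    rw [norm_mul]; exact mul_le_mul hQ hXn (norm_nonneg _) ha0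
  have t3 : ‖q₀ * -(u * v * (w - u))‖ ≤ 3 * (uR * δ) := by
    rw [norm_mul, norm_neg]; exact mul_le_mul hq₀ huvw (norm_nonneg _) (by norm_num)
  have t4 : ‖(R1 - r₀) * Y‖ ≤ a' * (7 * uR) := by
    rw [norm_mul]; exact mul_le_mul hR hYn (norm_nonneg _) ha0'
  have t5 : ‖r₀ * ((w - u) * (2 * v - (w + u) - u * v))‖ ≤ 1 * (δ * 4) := by
    rw [norm_mul, norm_mul]
    exact mul_le_mul hr₀ (mul_le_mul hwu hZn (norm_nonneg _) hδ0) (by positivity) (by norm_num)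
  have hsum := norm_add_le_of_le (norm_add_le_of_le (norm_add_le_of_le (norm_add_le_of_le t1 t2) t3) t4) t5
  refine hsum.trans ?_
  nlinarith [mul_nonneg hu0 hδ0]

/-! ## §2. The local ratios `Q − 1`, `R − 1`, `P − 1` as quotients by `1 + λ₁(q)·sumA6` -/

/-- **The three local ratios of the closed form, as quotients** (at `s₀ = 1 − βⱼ`): with
`D_F = 1 + λ₁(q)·sumA6(q,s₀)` (so that `F_q(1,1;s₀) = Z_q(s₀)·D_F`, `AppendixALocal.calM1Factor_one_one_eq`),
`Q − 1 = λ₁(q)·B′/D_F` where `B′ = Σ_{r≥1}(χ(q)q/(q−1))κ₁(q^{r−1})q^{−rs₀}`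
(`Lemma153Rp.calM1Factor_one_prime_sub`), `R − 1 = ((λ₁(q) − 1) + λ₁(q)·E)/D_F` where
`E = Σ_{r≥1}(κ₁(qʳ) − κ̃₁(qʳ;1))q^{−rs₀}` (`lam_mul_calM1Factor_prime_one_sub`), and
`P − 1 = (Q − 1) + (R − 1)` (`lam_mul_calM1Factor_prime_prime_sub`); also `D_F ≠ 0`.
[cite: Zhang2022LandauSiegel, App. A (A.5) p. 103, p. 105] -/
theorem localRatios_eq (c' : ℝ) {D : ℕ} [NeZero D] (χ : DirichletCharacter ℂ D) {q : ℕ}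
    (hq : q.Prime) (j : ℕ)
    (hmul : Multipliable fun p : Nat.Primes =>
      calM1Factor c' χ (p : ℕ) 1 1 (1 - Skeleton.betaJ c' D j))
    (hne : calM1 c' χ 1 1 (1 - Skeleton.betaJ c' D j) ≠ 0) :
    (1 + lam1 c' χ q 1 * Typed.AppendixA2.sumA6 c' χ q (1 - Skeleton.betaJ c' D j)) ≠ 0 ∧
    calM1Factor c' χ q 1 q (1 - Skeleton.betaJ c' D j) /
          calM1Factor c' χ q 1 1 (1 - Skeleton.betaJ c' D j) - 1 =
        lam1 c' χ q 1 *
            (∑' r : ℕ, if r = 0 then (0 : ℂ) else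
              χ (q : ZMod D) * (q : ℂ) / ((q : ℂ) - 1) * kappa1 c' D (q ^ (r - 1)) /
                (q : ℂ) ^ ((r : ℂ) * (1 - Skeleton.betaJ c' D j))) /
          (1 + lam1 c' χ q 1 * Typed.AppendixA2.sumA6 c' χ q (1 - Skeleton.betaJ c' D j)) ∧
    lam1 c' χ q 1 * calM1Factor c' χ q q 1 (1 - Skeleton.betaJ c' D j) /
          calM1Factor c' χ q 1 1 (1 - Skeleton.betaJ c' D j) - 1 =
        ((lam1 c' χ q 1 - 1) + lam1 c' χ q 1 *
            ∑' r : ℕ, if r = 0 then (0 : ℂ) else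
              (kappa1 c' D (q ^ r) - kappaTilde1 c' χ (q ^ r) 1 1) /
                (q : ℂ) ^ ((r : ℂ) * (1 - Skeleton.betaJ c' D j))) /
          (1 + lam1 c' χ q 1 * Typed.AppendixA2.sumA6 c' χ q (1 - Skeleton.betaJ c' D j)) ∧
    lam1 c' χ q 1 * calM1Factor c' χ q q q (1 - Skeleton.betaJ c' D j) /
          calM1Factor c' χ q 1 1 (1 - Skeleton.betaJ c' D j) - 1 =
        (calM1Factor c' χ q 1 q (1 - Skeleton.betaJ c' D j) /
            calM1Factor c' χ q 1 1 (1 - Skeleton.betaJ c' D j) - 1) +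
          (lam1 c' χ q 1 * calM1Factor c' χ q q 1 (1 - Skeleton.betaJ c' D j) /
            calM1Factor c' χ q 1 1 (1 - Skeleton.betaJ c' D j) - 1) := by
  set s₀ : ℂ := 1 - Skeleton.betaJ c' D j with hs₀
  have hs : 0 < s₀.re := by rw [hs₀, Lemma153Rp.one_sub_betaJ_re]; norm_num
  have hF0 : calM1Factor c' χ q 1 1 s₀ ≠ 0 :=
    Lemma153Rp.calM1Factor_ne_zero_of_calM1_ne_zero c' χ hmul hne ⟨q, hq⟩
  have h11 : calM1Factor c' χ q 1 1 s₀ = Typed.AppendixA2.zetaFactor1 c' χ q s₀ *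
      (1 + lam1 c' χ q 1 * Typed.AppendixA2.sumA6 c' χ q s₀) :=
    AppendixALocal.calM1Factor_one_one_eq c' χ
      (fun q r hq hr => Lemma153Rp.xi1_prime_pow_of_coprime c' χ hq le_rfl le_rfl hr
        (Nat.coprime_one_right q))
      (fun q hq => Lemma153Rp.lamTilde1_prime_one_eq c' χ hq) hq s₀
  have hZD : Typed.AppendixA2.zetaFactor1 c' χ q s₀ ≠ 0 ∧
      (1 + lam1 c' χ q 1 * Typed.AppendixA2.sumA6 c' χ q s₀) ≠ 0 :=
    mul_ne_zero_iff.mp (h11 ▸ hF0)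
  set DF : ℂ := 1 + lam1 c' χ q 1 * Typed.AppendixA2.sumA6 c' χ q s₀ with hDF
  set Z : ℂ := Typed.AppendixA2.zetaFactor1 c' χ q s₀ with hZ
  have hZdef : Z = (1 - (q : ℂ) ^ (-(s₀ + Skeleton.beta1 c' D))) *
      (1 - (q : ℂ) ^ (-(s₀ + Skeleton.beta2 c' D))) /
        ((1 - (q : ℂ) ^ (-s₀)) * (1 - χ (q : ZMod D) * (q : ℂ) ^ (-s₀))) := rfl
  have h1q := Lemma153Rp.calM1Factor_one_prime_sub c' χ hq hs
  have hq1 := Lemma153Rp.lam_mul_calM1Factor_prime_one_sub c' χ hq hs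
  have hqq := Lemma153Rp.lam_mul_calM1Factor_prime_prime_sub c' χ hq hs
  rw [← hZdef] at h1q hq1
  have ediv : ∀ X : ℂ, X / calM1Factor c' χ q 1 1 s₀ - 1 =
      (X - calM1Factor c' χ q 1 1 s₀) / calM1Factor c' χ q 1 1 s₀ := fun X => by
    rw [sub_div, div_self hF0]
  refine ⟨hZD.2, ?_, ?_, ?_⟩
  · rw [ediv, h1q, h11, mul_div_mul_left _ _ hZD.1]
  · rw [ediv, hq1, h11, mul_div_mul_left _ _ hZD.1]
  · rw [ediv, ediv, ediv, hqq, add_div]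

/-! ## §3. The series `B′` and `E` at `s` with `|s − 1| < 5α` (`β`-perturbations, App. A pp. 103–105) -/

/-- `a/q^{(r:ℂ)s} = a·(q^{−s})ʳ`. [folklore] -/
private theorem div_cpow_natMul_eq {q : ℕ} (a : ℂ) (r : ℕ) (s : ℂ) :
    a / (q : ℂ) ^ ((r : ℂ) * s) = a * ((q : ℂ) ^ (-s)) ^ r := by
  rw [Complex.cpow_nat_mul, Complex.cpow_neg, inv_pow, div_eq_mul_inv]

/-- **The series `B′ = Σ_{r≥1}(χ(q)q/(q−1))κ₁(q^{r−1})q^{−rs} = (v/(1−u))·u/(1−u) + O(α log q/q)`**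
(`u = q⁻¹`, `v = χ(q)`; `q < D` prime, `|s − 1| < 5α`, `D ≥ D₀(c′)`): `|κ₁(q^{r−1}) − 1| ≤ (r−1)(|b₁|+|b₂|) log q`
(`AppendixALocal.norm_kappa₁_prime_pow_sub_one_le`) and `|q^{−s} − q⁻¹| ≤ 10αq⁻¹ log q`
(`AppendixALocal.local_estimates`); bound `212·α log q/q`. [cite: Zhang2022LandauSiegel, App. A (A.5) p. 103, p. 105] -/
theorem norm_Bser_sub_le (c' : ℝ) {D : ℕ} [NeZero D] (χ : DirichletCharacter ℂ D)
    (hD : ⌈Real.exp (7 * π * |c'| + 32)⌉₊ + 1 ≤ D) {q : ℕ} (hq : q.Prime) (hqD : q < D)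
    {s : ℂ} (hs : ‖s - 1‖ < 5 * Skeleton.alpha D) :
    ‖(∑' r : ℕ, if r = 0 then (0 : ℂ) else
        χ (q : ZMod D) * (q : ℂ) / ((q : ℂ) - 1) * kappa1 c' D (q ^ (r - 1)) /
          (q : ℂ) ^ ((r : ℂ) * s)) -
      χ (q : ZMod D) / (1 - (q : ℂ)⁻¹) * ((q : ℂ)⁻¹ / (1 - (q : ℂ)⁻¹))‖ ≤
      212 * (Skeleton.alpha D * Real.log q / q) := by
  obtain ⟨-, hb, -, hα0⟩ := AppendixALocal.threshold c' hD
  obtain ⟨hwu, -, hw2, hw35, -, -⟩ := AppendixALocal.local_estimates c' hD hq hqD hs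
  have hv : ‖χ (q : ZMod D)‖ ≤ 1 := χ.norm_le_one _
  have hu : ‖(q : ℂ)⁻¹‖ ≤ 1 / 2 := AppendixALocal.norm_inv_natCast_le_half hq.two_le
  have hlog : 0 ≤ Real.log q := Real.log_natCast_nonneg q
  have hq0 : (0 : ℝ) < q := by exact_mod_cast hq.pos
  set w : ℂ := (q : ℂ) ^ (-s) with hw_def
  set u : ℂ := (q : ℂ)⁻¹ with hu_def
  set v : ℂ := χ (q : ZMod D) with hv_def
  set εb : ℝ := (|Skeleton.b1 c' D| + |Skeleton.b2 c' D|) * Real.log q with hεb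
  have hεb0 : 0 ≤ εb := by positivity
  have hεb4 : εb ≤ 4 * Skeleton.alpha D * Real.log q := by
    rw [hεb]; exact mul_le_mul_of_nonneg_right hb hlog
  -- the coefficient bound
  have hf : ∀ r : ℕ, 1 ≤ r → ‖(kappa1 c' D (q ^ (r - 1)) : ℂ) - 1‖ ≤ r * εb := by
    intro r hr
    have h := AppendixALocal.norm_kappa₁_prime_pow_sub_one_le (Skeleton.b1 c' D) (Skeleton.b2 c' D)
      hq (r - 1)
    have hr1 : ((r - 1 : ℕ) : ℝ) ≤ r := by rw [Nat.cast_sub hr]; push_cast; linarith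
    calc ‖(kappa1 c' D (q ^ (r - 1)) : ℂ) - 1‖ ≤ ((r - 1 : ℕ) : ℝ) * εb := h
      _ ≤ r * εb := by gcongr
  obtain ⟨-, hmain⟩ := summable_and_norm_tsum_ite_mul_pow_sub_le (c := 1) hεb0 hw35 hf
  -- rewrite the series
  have hcB : χ (q : ZMod D) * (q : ℂ) / ((q : ℂ) - 1) = v / (1 - u) :=
    AppendixALocal.chi_mul_div_eq χ hq.two_le
  have hser : (∑' r : ℕ, if r = 0 then (0 : ℂ) else
      χ (q : ZMod D) * (q : ℂ) / ((q : ℂ) - 1) * kappa1 c' D (q ^ (r - 1)) /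
        (q : ℂ) ^ ((r : ℂ) * s)) =
      v / (1 - u) * ∑' r : ℕ, if r = 0 then (0 : ℂ) else (kappa1 c' D (q ^ (r - 1)) : ℂ) * w ^ r := by
    rw [← tsum_mul_left]
    refine tsum_congr fun r => ?_
    by_cases hr : r = 0
    · simp [hr]
    · rw [if_neg hr, if_neg hr, div_cpow_natMul_eq, hcB]; ring
  rw [hser]
  have hcBn : ‖v / (1 - u)‖ ≤ 2 := AppendixALocal.norm_div_one_sub_le_two hu hv
  have hgeo : ‖w / (1 - w) - u / (1 - u)‖ ≤ 5 * ‖w - u‖ :=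
    AppendixALocal.norm_div_one_sub_sub_le hw35 hu
  have e : v / (1 - u) * (∑' r : ℕ, if r = 0 then (0 : ℂ) else (kappa1 c' D (q ^ (r - 1)) : ℂ) * w ^ r) -
      v / (1 - u) * (u / (1 - u)) =
      v / (1 - u) * (((∑' r : ℕ, if r = 0 then (0 : ℂ) else (kappa1 c' D (q ^ (r - 1)) : ℂ) * w ^ r) -
        1 * (w / (1 - w))) + (w / (1 - w) - u / (1 - u))) := by ring
  rw [e, norm_mul]
  have hin : ‖((∑' r : ℕ, if r = 0 then (0 : ℂ) else (kappa1 c' D (q ^ (r - 1)) : ℂ) * w ^ r) -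
        1 * (w / (1 - w))) + (w / (1 - w) - u / (1 - u))‖ ≤
      7 * εb * ‖w‖ + 5 * ‖w - u‖ := (norm_add_le _ _).trans (add_le_add hmain hgeo)
  have hwn : ‖w‖ ≤ 2 * (q : ℝ)⁻¹ := hw2
  have hwun : ‖w - u‖ ≤ 10 * (q : ℝ)⁻¹ * (Skeleton.alpha D * Real.log q) := hwu
  calc ‖v / (1 - u)‖ * ‖((∑' r : ℕ, if r = 0 then (0 : ℂ) else (kappa1 c' D (q ^ (r - 1)) : ℂ) * w ^ r) -
          1 * (w / (1 - w))) + (w / (1 - w) - u / (1 - u))‖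
      ≤ 2 * (7 * εb * ‖w‖ + 5 * ‖w - u‖) := mul_le_mul hcBn hin (norm_nonneg _) (by norm_num)
    _ ≤ 2 * (7 * (4 * Skeleton.alpha D * Real.log q) * (2 * (q : ℝ)⁻¹) +
          5 * (10 * (q : ℝ)⁻¹ * (Skeleton.alpha D * Real.log q))) := by gcongr
    _ = 212 * (Skeleton.alpha D * Real.log q / q) := by field_simp; ring

/-- **The series `E = Σ_{r≥1}(κ₁(qʳ) − κ̃₁(qʳ;1))q^{−rs} = (1 − 1/(1−vu))·u/(1−u) + O(α log q/q)`**
(`u = q⁻¹`, `v = χ(q)`; `q < D` prime, `|s − 1| < 5α`, `D ≥ D₀(c′)`): the coefficients are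
`1 − 1/(1−vu) + O(r·α log q)` by `AppendixALocal.norm_kappa₁_prime_pow_sub_one_le` and
`norm_kappaTildeOneLocal_sub_le` (u024); bound `330·α log q/q`. [cite: Zhang2022LandauSiegel, App. A p. 104, p. 105] -/
theorem norm_Eser_sub_le (c' : ℝ) {D : ℕ} [NeZero D] (χ : DirichletCharacter ℂ D)
    (hD : ⌈Real.exp (7 * π * |c'| + 32)⌉₊ + 1 ≤ D) {q : ℕ} (hq : q.Prime) (hqD : q < D)
    {s : ℂ} (hs : ‖s - 1‖ < 5 * Skeleton.alpha D) :
    ‖(∑' r : ℕ, if r = 0 then (0 : ℂ) else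
        (kappa1 c' D (q ^ r) - kappaTilde1 c' χ (q ^ r) 1 1) / (q : ℂ) ^ ((r : ℂ) * s)) -
      (1 - 1 / (1 - χ (q : ZMod D) * (q : ℂ)⁻¹)) * ((q : ℂ)⁻¹ / (1 - (q : ℂ)⁻¹))‖ ≤
      330 * (Skeleton.alpha D * Real.log q / q) := by
  obtain ⟨-, hb, -, hα0⟩ := AppendixALocal.threshold c' hD
  obtain ⟨hwu, -, hw2, hw35, -, -⟩ := AppendixALocal.local_estimates c' hD hq hqD hs
  have hv : ‖χ (q : ZMod D)‖ ≤ 1 := χ.norm_le_one _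
  have hu : ‖(q : ℂ)⁻¹‖ ≤ 1 / 2 := AppendixALocal.norm_inv_natCast_le_half hq.two_le
  have hlog : 0 ≤ Real.log q := Real.log_natCast_nonneg q
  have hq0 : (0 : ℝ) < q := by exact_mod_cast hq.pos
  set w : ℂ := (q : ℂ) ^ (-s) with hw_def
  set u : ℂ := (q : ℂ)⁻¹ with hu_def
  set v : ℂ := χ (q : ZMod D) with hv_def
  set εb : ℝ := (|Skeleton.b1 c' D| + |Skeleton.b2 c' D|) * Real.log q with hεb
  have hεb0 : 0 ≤ εb := by positivity
  have hεb4 : εb ≤ 4 * Skeleton.alpha D * Real.log q := by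
    rw [hεb]; exact mul_le_mul_of_nonneg_right hb hlog
  set c : ℂ := 1 - 1 / (1 - v * u) with hc
  -- the coefficient bound
  have hf : ∀ r : ℕ, 1 ≤ r →
      ‖((kappa1 c' D (q ^ r) : ℂ) - kappaTilde1 c' χ (q ^ r) 1 1) - c‖ ≤ r * (5 * εb) := by
    intro r hr
    have h1 : ‖(kappa1 c' D (q ^ r) : ℂ) - 1‖ ≤ r * εb :=
      AppendixALocal.norm_kappa₁_prime_pow_sub_one_le (Skeleton.b1 c' D) (Skeleton.b2 c' D) hq r
    have h2 : ‖kappaTilde1 c' χ (q ^ r) 1 1 - 1 / (1 - v * u)‖ ≤ 4 * r * εb := by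
      rw [AppendixALocal.kappaTilde1_prime_pow_eq c' χ hq hr]
      exact AppendixALocal.norm_kappaTildeOneLocal_sub_le (Skeleton.b1 c' D) (Skeleton.b2 c' D)
        hv hq hr
    have e : ((kappa1 c' D (q ^ r) : ℂ) - kappaTilde1 c' χ (q ^ r) 1 1) - c =
        ((kappa1 c' D (q ^ r) : ℂ) - 1) - (kappaTilde1 c' χ (q ^ r) 1 1 - 1 / (1 - v * u)) := by
      rw [hc]; ring
    rw [e]
    calc _ ≤ ‖(kappa1 c' D (q ^ r) : ℂ) - 1‖ + ‖kappaTilde1 c' χ (q ^ r) 1 1 - 1 / (1 - v * u)‖ :=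
          norm_sub_le _ _
      _ ≤ r * εb + 4 * r * εb := add_le_add h1 h2
      _ = r * (5 * εb) := by ring
  obtain ⟨-, hmain⟩ := summable_and_norm_tsum_ite_mul_pow_sub_le (by positivity) hw35 hf
  -- rewrite the series
  have hser : (∑' r : ℕ, if r = 0 then (0 : ℂ) else
      (kappa1 c' D (q ^ r) - kappaTilde1 c' χ (q ^ r) 1 1) / (q : ℂ) ^ ((r : ℂ) * s)) =
      ∑' r : ℕ, if r = 0 then (0 : ℂ) else
        ((kappa1 c' D (q ^ r) : ℂ) - kappaTilde1 c' χ (q ^ r) 1 1) * w ^ r := by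
    refine tsum_congr fun r => ?_
    by_cases hr : r = 0
    · simp [hr]
    · rw [if_neg hr, if_neg hr, div_cpow_natMul_eq]
  rw [hser]
  -- `‖c‖ ≤ 1`
  have hne : (1 : ℂ) - v * u ≠ 0 := AppendixALocal.one_sub_ne_zero hu hv
  have hcn : ‖c‖ ≤ 1 := by
    have hc' : c = -(v * u) / (1 - v * u) := by rw [hc]; field_simp; ring
    rw [hc', norm_div, norm_neg, div_le_one (norm_pos_iff.mpr hne)]
    have h1 := AppendixALocal.half_le_norm_one_sub hu hv
    have h2 : ‖v * u‖ ≤ 1 / 2 := by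
      rw [norm_mul]
      calc ‖v‖ * ‖u‖ ≤ 1 * (1 / 2) := by gcongr
        _ = 1 / 2 := by ring
    linarith
  have hgeo : ‖w / (1 - w) - u / (1 - u)‖ ≤ 5 * ‖w - u‖ :=
    AppendixALocal.norm_div_one_sub_sub_le hw35 hu
  have e : (∑' r : ℕ, if r = 0 then (0 : ℂ) else
        ((kappa1 c' D (q ^ r) : ℂ) - kappaTilde1 c' χ (q ^ r) 1 1) * w ^ r) - c * (u / (1 - u)) =
      ((∑' r : ℕ, if r = 0 then (0 : ℂ) else
        ((kappa1 c' D (q ^ r) : ℂ) - kappaTilde1 c' χ (q ^ r) 1 1) * w ^ r) - c * (w / (1 - w))) +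
        c * (w / (1 - w) - u / (1 - u)) := by ring
  rw [e]
  have hwn : ‖w‖ ≤ 2 * (q : ℝ)⁻¹ := hw2
  have hwun : ‖w - u‖ ≤ 10 * (q : ℝ)⁻¹ * (Skeleton.alpha D * Real.log q) := hwu
  calc _ ≤ ‖(∑' r : ℕ, if r = 0 then (0 : ℂ) else
          ((kappa1 c' D (q ^ r) : ℂ) - kappaTilde1 c' χ (q ^ r) 1 1) * w ^ r) - c * (w / (1 - w))‖ +
          ‖c * (w / (1 - w) - u / (1 - u))‖ := norm_add_le _ _
    _ ≤ 7 * (5 * εb) * ‖w‖ + 1 * (5 * ‖w - u‖) := by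
        refine add_le_add hmain ?_
        rw [norm_mul]; exact mul_le_mul hcn hgeo (norm_nonneg _) zero_le_one
    _ ≤ 7 * (5 * (4 * Skeleton.alpha D * Real.log q)) * (2 * (q : ℝ)⁻¹) +
          1 * (5 * (10 * (q : ℝ)⁻¹ * (Skeleton.alpha D * Real.log q))) := by gcongr
    _ = 330 * (Skeleton.alpha D * Real.log q / q) := by field_simp; ring

/-! ## §4. The value at `s = 1`: `hval` -/

set_option maxHeartbeats 400000 in
/-- **(V) — the value at `1` of the repaired Euler factor** (App. A p. 105, the "value" half of
the sketch of Lemma 15.3, for the REPAIRED factor `𝔲ᴿ₁ⱼ(q,s)` = `Typed.AppendixA2.frakU1FactorR`;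
this is the hypothesis `hval` of `Typed.Section15C.step15_u053R_of_local` VERBATIM): for all
large `D`, under (A), `1 ≤ j ≤ 3`, every prime `q ∤ D` with `q ≤ D`,
`‖𝔲ᴿ₁ⱼ(q,1) − (1 − q⁻²)²/(1 − χ(q)q⁻²)‖ ≤ C·α·log q/q`.
Proof: closed form (`Lemma153Rp.frakU1FactorR_eq_poly`) + local ratios (`localRatios_eq`) +
the App.-A `β`-perturbation estimates at `s = 1 − βⱼ` (`AppendixALocal.stepA_u026_holds`,
`stepA_u027_holds`, `norm_Bser_sub_le`, `norm_Eser_sub_le`, `local_estimates`) + `main_term_identity`.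
[cite: Zhang2022LandauSiegel, App. A p. 105; §15 Lemma 15.3 p. 87] -/
theorem hval_holds (c' : ℝ) :
    ∃ C : ℝ, Skeleton.ForAllLarge fun D _ χ => Skeleton.AssumptionA D χ →
      ∀ j ∈ ({1, 2, 3} : Finset ℕ), ∀ q : ℕ, q.Prime → ¬ q ∣ D → (q : ℝ) ≤ D →
        ‖Typed.AppendixA2.frakU1FactorR c' χ j q 1 -
            (1 - 1 / ((q : ℂ)) ^ 2) ^ 2 / (1 - χ (q : ZMod D) / ((q : ℂ)) ^ 2)‖ ≤
          C * (Skeleton.alpha D * Real.log q / q) := by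
  obtain ⟨C₆, h26⟩ := AppendixALocal.stepA_u026_holds c'
  obtain ⟨C₇, h27⟩ := AppendixALocal.stepA_u027_holds c'
  have h18 := Lemma153Rp.eq15_18_at_betaJ c'
  set K₆ : ℝ := max C₆ 0 with hK₆
  set K₇ : ℝ := max C₇ 1 with hK₇
  have hK₆0 : 0 ≤ K₆ := le_max_right _ _
  have hC₆K : C₆ ≤ K₆ := le_max_left _ _
  have hK₇1 : 1 ≤ K₇ := le_max_right _ _
  have hC₇K : C₇ ≤ K₇ := le_max_left _ _
  -- thresholds
  set ε : ℝ := 1 / (2 * K₆ + 2 * K₇ + 15 * |c'| + 1) with hε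
  have hKsum : 0 < 2 * K₆ + 2 * K₇ + 15 * |c'| + 1 := by
    have := abs_nonneg c'; linarith
  have hεpos : 0 < ε := by rw [hε]; exact div_pos one_pos hKsum
  have hεK : ε * (2 * K₆ + 2 * K₇ + 15 * |c'| + 1) = 1 := by rw [hε]; field_simp
  set D₁ : ℕ := ⌈Real.exp (7 * π * |c'| + 32)⌉₊ + 1 with hD₁
  set D₂ : ℕ := ⌈Real.exp (Real.pi / ε + 1)⌉₊ + 1 with hD₂
  have hT : Skeleton.ForAllLarge fun D _ _ => D₁ ≤ D ∧ D₂ ≤ D ∧ 3 ≤ D :=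
    Skeleton.ForAllLarge.of_le (max D₁ (max D₂ 3)) fun D _ _ hD _ _ =>
      ⟨le_trans (le_max_left _ _) hD, le_trans ((le_max_left _ _).trans (le_max_right _ _)) hD,
        le_trans ((le_max_right _ _).trans (le_max_right _ _)) hD⟩
  refine ⟨100 * K₆ + 100 * K₇ + 10000, (hT.and (h26.and (h27.and h18))).mono ?_⟩
  intro D _ χ hquad _ h hA j hj q hq hqd hqD
  obtain ⟨⟨hD₁', hD₂', hD3⟩, h26D, h27D, h18D⟩ := h
  -- `q < D`, `(q, D) = 1`, `χ(q) = ±1`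
  have hqD' : q < D := by
    by_contra hge
    have hge' : D ≤ q := not_lt.mp hge
    have hqle : q ≤ D := by exact_mod_cast hqD
    exact hqd (le_antisymm hqle hge' ▸ dvd_refl q)
  have hcop : Nat.Coprime q D := (Nat.Prime.coprime_iff_not_dvd hq).mpr hqd
  have hv1 : χ (q : ZMod D) = 1 ∨ χ (q : ZMod D) = -1 :=
    AppendixALocal.chi_val_eq_one_or_neg_one χ hquad hcop
  have hvsq : χ (q : ZMod D) ^ 2 = 1 := by rcases hv1 with h | h <;> simp [h]
  have hvn : ‖χ (q : ZMod D)‖ ≤ 1 := χ.norm_le_one _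
  -- scales
  obtain ⟨hℓ32, -, h200, hα0⟩ := AppendixALocal.threshold c' hD₁'
  have hℓ0 : 0 ≤ Skeleton.ell D := by linarith
  have hαℓ : Skeleton.alpha D * Skeleton.ell D ≤ ε := Lemma153Rp.alpha_mul_ell_le_of_le hεpos hD₂'
  have hαℓ0 : 0 ≤ Skeleton.alpha D * Skeleton.ell D := mul_nonneg hα0.le hℓ0
  have hcε : 0 ≤ |c'| * ε := mul_nonneg (abs_nonneg _) hεpos.le
  have hK₆ε' : 0 ≤ K₆ * ε := mul_nonneg hK₆0 hεpos.le
  have hK₇ε' : 0 ≤ K₇ * ε := mul_nonneg (zero_le_one.trans hK₇1) hεpos.le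
  have hεK' : ε * (2 * K₆ + 2 * K₇ + 15 * |c'| + 1) =
      2 * (K₆ * ε) + 2 * (K₇ * ε) + 15 * (|c'| * ε) + ε := by ring
  have hsmall : 15 * |c'| * (Skeleton.alpha D * Skeleton.ell D) < 2 := by
    have h1 : 15 * |c'| * (Skeleton.alpha D * Skeleton.ell D) ≤ 15 * |c'| * ε :=
      mul_le_mul_of_nonneg_left hαℓ (by linarith [abs_nonneg c'])
    have h2 : 15 * |c'| * ε ≤ 1 := by linarith
    linarith
  have hK6 : K₆ * (Skeleton.alpha D * Skeleton.ell D) ≤ 1 / 2 := by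
    have h1 : K₆ * (Skeleton.alpha D * Skeleton.ell D) ≤ K₆ * ε :=
      mul_le_mul_of_nonneg_left hαℓ hK₆0
    have h2 : K₆ * ε ≤ 1 / 2 := by linarith
    linarith
  have hK7 : K₇ * (Skeleton.alpha D * Skeleton.ell D) ≤ 1 / 2 := by
    have h1 : K₇ * (Skeleton.alpha D * Skeleton.ell D) ≤ K₇ * ε :=
      mul_le_mul_of_nonneg_left hαℓ (zero_le_one.trans hK₇1)
    have h2 : K₇ * ε ≤ 1 / 2 := by linarith
    linarith
  -- `s₀ = 1 − βⱼ`
  have hβ : ‖Skeleton.betaJ c' D j‖ < 5 * Skeleton.alpha D :=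
    Lemma153Rp.norm_betaJ_lt c' hD3 hsmall j
  have hs : ‖(1 - Skeleton.betaJ c' D j) - 1‖ < 5 * Skeleton.alpha D := by
    rw [sub_sub_cancel_left, norm_neg]; exact hβ
  -- local estimates at `s₀`
  obtain ⟨hwu, -, hw2, hw35, -, hlogℓ⟩ := AppendixALocal.local_estimates c' hD₁' hq hqD' hs
  have hq0 : (0 : ℝ) < q := by exact_mod_cast hq.pos
  have hq2 : (2 : ℝ) ≤ q := by exact_mod_cast hq.two_le
  have hlog : 0 ≤ Real.log q := Real.log_natCast_nonneg q
  -- multipliability / non-vanishing of `𝓜₁(1,1;s₀)` and the local ratios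
  obtain ⟨hhalf, hmul, -⟩ := h18D hA j
  have hne : calM1 c' χ 1 1 (1 - Skeleton.betaJ c' D j) ≠ 0 := by
    intro h0; rw [h0, norm_zero] at hhalf; linarith
  obtain ⟨hDF, hQ1, hR1, hP1⟩ := localRatios_eq c' χ hq j hmul hne
  -- the tree inputs at `q`, `s₀`
  have h26q := h26D hA q hq hqD'
  have h27q := h27D hA q (1 - Skeleton.betaJ c' D j) hq hqD' hs
  have hB := norm_Bser_sub_le c' χ hD₁' hq hqD' hs
  have hE := norm_Eser_sub_le c' χ hD₁' hq hqD' hs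
  -- the closed form at `s = 1`
  have hU := Lemma153Rp.frakU1FactorR_eq_poly c' χ hq hvsq j hmul hne (s := 1)
    (by norm_num : (0 : ℝ) < (1 : ℂ).re)
  have hw' : χ (q : ZMod D) * (q : ℂ) ^ Skeleton.betaJ c' D j * (q : ℂ) ^ (-(1 : ℂ)) =
      χ (q : ZMod D) * (q : ℂ) ^ (-(1 - Skeleton.betaJ c' D j)) := by
    rw [mul_assoc, ← Lemma153Rp.cpow_neg_sub_betaJ c' hq j 1]
  rw [hw', Complex.cpow_neg_one] at hU
  -- names (introduced now, so that every hypothesis in context is folded consistently)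
  set Qr : ℂ := calM1Factor c' χ q 1 q (1 - Skeleton.betaJ c' D j) /
    calM1Factor c' χ q 1 1 (1 - Skeleton.betaJ c' D j) with hQr
  set Rr : ℂ := lam1 c' χ q 1 * calM1Factor c' χ q q 1 (1 - Skeleton.betaJ c' D j) /
    calM1Factor c' χ q 1 1 (1 - Skeleton.betaJ c' D j) with hRr
  set Pr : ℂ := lam1 c' χ q 1 * calM1Factor c' χ q q q (1 - Skeleton.betaJ c' D j) /
    calM1Factor c' χ q 1 1 (1 - Skeleton.betaJ c' D j) with hPr
  set Bser : ℂ := ∑' r : ℕ, if r = 0 then (0 : ℂ) else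
      χ (q : ZMod D) * (q : ℂ) / ((q : ℂ) - 1) * kappa1 c' D (q ^ (r - 1)) /
        (q : ℂ) ^ ((r : ℂ) * (1 - Skeleton.betaJ c' D j)) with hBser
  set Eser : ℂ := ∑' r : ℕ, if r = 0 then (0 : ℂ) else
      (kappa1 c' D (q ^ r) - kappaTilde1 c' χ (q ^ r) 1 1) /
        (q : ℂ) ^ ((r : ℂ) * (1 - Skeleton.betaJ c' D j)) with hEser
  set DF : ℂ := 1 + lam1 c' χ q 1 * Typed.AppendixA2.sumA6 c' χ q (1 - Skeleton.betaJ c' D j)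
    with hDFdef
  set w : ℂ := (q : ℂ) ^ (-(1 - Skeleton.betaJ c' D j)) with hw_def
  set lam : ℂ := lam1 c' χ q 1 with hlam
  set u : ℂ := (q : ℂ)⁻¹ with hu_def
  set v : ℂ := χ (q : ZMod D) with hv_def
  set ε₁ : ℝ := Skeleton.alpha D * Real.log q / q with hε₁
  set uR : ℝ := (q : ℝ)⁻¹ with huR
  -- scalar facts
  have hε₁0 : 0 ≤ ε₁ := by
    rw [hε₁]; exact div_nonneg (mul_nonneg hα0.le hlog) hq0.le
  have hε₁le : ε₁ ≤ Skeleton.alpha D * Skeleton.ell D := by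
    rw [hε₁, div_le_iff₀ hq0]
    have h1 : Skeleton.alpha D * Real.log q ≤ Skeleton.alpha D * Skeleton.ell D :=
      mul_le_mul_of_nonneg_left hlogℓ hα0.le
    calc Skeleton.alpha D * Real.log q ≤ Skeleton.alpha D * Skeleton.ell D := h1
      _ = Skeleton.alpha D * Skeleton.ell D * 1 := (mul_one _).symm
      _ ≤ Skeleton.alpha D * Skeleton.ell D * q :=
          mul_le_mul_of_nonneg_left (by linarith) hαℓ0
  have hK6ε : K₆ * ε₁ ≤ 1 / 2 := (mul_le_mul_of_nonneg_left hε₁le hK₆0).trans hK6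
  have hK7ε : K₇ * ε₁ ≤ 1 / 2 :=
    (mul_le_mul_of_nonneg_left hε₁le (zero_le_one.trans hK₇1)).trans hK7
  have h330ε : 330 * ε₁ ≤ 2 := by linarith
  have hK₆ε0 : 0 ≤ K₆ * ε₁ := mul_nonneg hK₆0 hε₁0
  have hK₇ε0 : 0 ≤ K₇ * ε₁ := mul_nonneg (zero_le_one.trans hK₇1) hε₁0
  have hu_cast : u = ((uR : ℝ) : ℂ) := by rw [hu_def, huR]; push_cast; rfl
  have hun : ‖u‖ = uR := by rw [hu_def, huR]; exact AppendixALocal.norm_inv_natCast q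
  have huR0 : 0 ≤ uR := by rw [huR]; exact inv_nonneg.mpr hq0.le
  have hu : ‖u‖ ≤ 1 / 2 := AppendixALocal.norm_inv_natCast_le_half hq.two_le
  have huR2 : uR ≤ 1 / 2 := hun ▸ hu
  have hδ : ‖w - u‖ ≤ 10 * ε₁ := by
    calc ‖w - u‖ ≤ 10 * (q : ℝ)⁻¹ * (Skeleton.alpha D * Real.log q) := hwu
      _ = 10 * ε₁ := by rw [hε₁]; field_simp
  have hw2' : ‖w‖ ≤ 2 * uR := hw2
  -- sizes of the model pieces
  have h1u : 1 / 2 ≤ ‖1 - u‖ := by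
    have := norm_sub_norm_le (1 : ℂ) u; rw [norm_one] at this; linarith
  have hvu : ‖v * u‖ ≤ 1 / 2 := by
    rw [norm_mul]
    calc ‖v‖ * ‖u‖ ≤ 1 * (1 / 2) := by gcongr
      _ = 1 / 2 := by ring
  have h1vu : ‖1 - v * u‖ ≤ 3 / 2 := by
    calc ‖1 - v * u‖ ≤ ‖(1 : ℂ)‖ + ‖v * u‖ := norm_sub_le _ _
      _ ≤ 1 + 1 / 2 := by rw [norm_one]; gcongr
      _ = 3 / 2 := by norm_num
  have h1vu0 : (1 : ℂ) - v * u ≠ 0 := AppendixALocal.one_sub_ne_zero hu hvn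
  have hudiv : ‖u / (1 - u)‖ ≤ 1 := by
    rw [norm_div, div_le_one (by linarith)]; linarith
  have hvdiv : ‖v / (1 - u)‖ ≤ 2 := AppendixALocal.norm_div_one_sub_le_two hu hvn
  have hMn : 1 ≤ ‖1 / (1 - u) - u * v * (1 - v * u) / (1 - u) ^ 2‖ :=
    one_le_norm_mainDen hv1 hu_cast huR0 huR2
  have hMinv : ‖1 / (1 - u) - u * v * (1 - v * u) / (1 - u) ^ 2‖⁻¹ ≤ 1 :=
    inv_le_one_of_one_le₀ hMn
  -- (1) `λ₁(q)`
  have hlam0 : ‖lam - (1 - v * u)‖ ≤ K₆ * ε₁ :=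
    h26q.trans (mul_le_mul_of_nonneg_right hC₆K hε₁0)
  have hlamn : ‖lam‖ ≤ 2 := by
    have := norm_add_le (lam - (1 - v * u)) (1 - v * u)
    rw [sub_add_cancel] at this
    linarith
  -- (2) `D_F`
  have hDFM : ‖DF - (1 / (1 - u) - u * v * (1 - v * u) / (1 - u) ^ 2)‖ ≤ K₇ * ε₁ :=
    h27q.trans (mul_le_mul_of_nonneg_right hC₇K hε₁0)
  -- (3) `Q − 1`
  have hNQ0 : ‖(1 - v * u) * (v / (1 - u)) * (u / (1 - u))‖ ≤ 3 := by
    rw [norm_mul, norm_mul]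
    calc ‖1 - v * u‖ * ‖v / (1 - u)‖ * ‖u / (1 - u)‖ ≤ 3 / 2 * 2 * 1 := by gcongr
      _ = 3 := by norm_num
  have hNQ : ‖lam * Bser - (1 - v * u) * (v / (1 - u)) * (u / (1 - u))‖ ≤ (4 * K₆ + 318) * ε₁ := by
    have hBn : ‖Bser‖ ≤ 4 := by
      have h1 := norm_add_le (Bser - v / (1 - u) * (u / (1 - u))) (v / (1 - u) * (u / (1 - u)))
      rw [sub_add_cancel, norm_mul] at h1
      have h2 : ‖v / (1 - u)‖ * ‖u / (1 - u)‖ ≤ 2 * 1 :=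
        mul_le_mul hvdiv hudiv (norm_nonneg _) (by norm_num)
      linarith
    have e : lam * Bser - (1 - v * u) * (v / (1 - u)) * (u / (1 - u)) =
        (lam - (1 - v * u)) * Bser + (1 - v * u) * (Bser - v / (1 - u) * (u / (1 - u))) := by ring
    rw [e]
    calc _ ≤ ‖(lam - (1 - v * u)) * Bser‖ + ‖(1 - v * u) * (Bser - v / (1 - u) * (u / (1 - u)))‖ :=
          norm_add_le _ _
      _ ≤ K₆ * ε₁ * 4 + 3 / 2 * (212 * ε₁) := by
          rw [norm_mul, norm_mul]
          exact add_le_add (mul_le_mul hlam0 hBn (norm_nonneg _) (by positivity))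
            (mul_le_mul h1vu hB (norm_nonneg _) (by norm_num))
      _ = (4 * K₆ + 318) * ε₁ := by ring
  have hQa : ‖(Qr - 1) - (1 - v * u) * (v / (1 - u)) * (u / (1 - u)) /
      (1 / (1 - u) - u * v * (1 - v * u) / (1 - u) ^ 2)‖ ≤
      2 * ((4 * K₆ + 318) * ε₁) + 2 * 3 * (K₇ * ε₁) := by
    rw [hQ1]
    exact norm_div_sub_div_le_of_approx hNQ hDFM hK7ε hMn hNQ0
  -- (4) `R − 1`
  have hcEn : ‖1 - 1 / (1 - v * u)‖ ≤ 1 := by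
    have hc' : 1 - 1 / (1 - v * u) = -(v * u) / (1 - v * u) := by field_simp; ring
    rw [hc', norm_div, norm_neg, div_le_one (norm_pos_iff.mpr h1vu0)]
    have h1 := AppendixALocal.half_le_norm_one_sub hu hvn
    linarith
  have hNR0 : ‖-(v * u) / (1 - u)‖ ≤ 2 := by
    rw [norm_div, norm_neg, div_le_iff₀ (by linarith)]; linarith
  have hNR : ‖((lam - 1) + lam * Eser) - (-(v * u) / (1 - u))‖ ≤ (4 * K₆ + 495) * ε₁ := by
    have hEn : ‖Eser‖ ≤ 3 := by
      have h1 := norm_add_le (Eser - (1 - 1 / (1 - v * u)) * (u / (1 - u)))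
        ((1 - 1 / (1 - v * u)) * (u / (1 - u)))
      rw [sub_add_cancel, norm_mul] at h1
      have h2 : ‖1 - 1 / (1 - v * u)‖ * ‖u / (1 - u)‖ ≤ 1 * 1 :=
        mul_le_mul hcEn hudiv (norm_nonneg _) (by norm_num)
      linarith
    have h1u0 : (1 : ℂ) - u ≠ 0 := by
      intro h0; rw [h0, norm_zero] at h1u; linarith
    have hN0 : -(v * u) / (1 - u) =
        ((1 - v * u) - 1) + (1 - v * u) * ((1 - 1 / (1 - v * u)) * (u / (1 - u))) := by
      field_simp; ring
    have e : ((lam - 1) + lam * Eser) - (-(v * u) / (1 - u)) =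
        (lam - (1 - v * u)) + (lam - (1 - v * u)) * Eser +
          (1 - v * u) * (Eser - (1 - 1 / (1 - v * u)) * (u / (1 - u))) := by rw [hN0]; ring
    rw [e]
    calc _ ≤ ‖lam - (1 - v * u)‖ + ‖(lam - (1 - v * u)) * Eser‖ +
          ‖(1 - v * u) * (Eser - (1 - 1 / (1 - v * u)) * (u / (1 - u)))‖ := norm_add₃_le
      _ ≤ K₆ * ε₁ + K₆ * ε₁ * 3 + 3 / 2 * (330 * ε₁) := by
          rw [norm_mul, norm_mul]
          exact add_le_add (add_le_add hlam0 (mul_le_mul hlam0 hEn (norm_nonneg _) (by positivity)))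
            (mul_le_mul h1vu hE (norm_nonneg _) (by norm_num))
      _ = (4 * K₆ + 495) * ε₁ := by ring
  have hRa : ‖(Rr - 1) - (-(v * u) / (1 - u)) /
      (1 / (1 - u) - u * v * (1 - v * u) / (1 - u) ^ 2)‖ ≤
      2 * ((4 * K₆ + 495) * ε₁) + 2 * 2 * (K₇ * ε₁) := by
    rw [hR1]
    exact norm_div_sub_div_le_of_approx hNR hDFM hK7ε hMn hNR0
  -- (5) sizes of `q₀`, `r₀`
  have hq₀ : ‖(1 - v * u) * (v / (1 - u)) * (u / (1 - u)) /
      (1 / (1 - u) - u * v * (1 - v * u) / (1 - u) ^ 2)‖ ≤ 3 := by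
    rw [norm_div, div_eq_mul_inv]
    calc _ ≤ 3 * 1 := mul_le_mul hNQ0 hMinv (by positivity) (by norm_num)
      _ = 3 := by norm_num
  have hr₀ : ‖-(v * u) / (1 - u) / (1 / (1 - u) - u * v * (1 - v * u) / (1 - u) ^ 2)‖ ≤ 1 := by
    rw [norm_div, div_eq_mul_inv]
    have h1 : ‖-(v * u) / (1 - u)‖ ≤ 1 := by
      rw [norm_div, norm_neg, div_le_one (by linarith)]; linarith
    calc _ ≤ 1 * 1 := mul_le_mul h1 hMinv (by positivity) (by norm_num)
      _ = 1 := by norm_num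
  -- (6) the closed form in the variables `u, v, w, Qr, Rr`
  have hPQR : Pr = (Qr - 1) + (Rr - 1) + 1 := by linear_combination hP1
  have hform : Typed.AppendixA2.frakU1FactorR c' χ j q 1 =
      (1 - u * v * w) + (Qr - 1) * (2 * u - u ^ 2 - u * v * w) +
        (Rr - 1) * (2 * v * w - w ^ 2 - u * v * w) := by
    rw [hU, hPQR]
    rcases hv1 with h | h <;> simp only [h] <;> ring
  -- (7) the main term
  have hmain := main_term_identity hv1 hu_cast huR0 huR2
  have htarget : (1 - 1 / ((q : ℂ)) ^ 2) ^ 2 / (1 - v / ((q : ℂ)) ^ 2) =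
      (1 - u ^ 2) ^ 2 / (1 - v * u ^ 2) := by
    rw [hu_def, inv_pow, one_div, div_eq_mul_inv v]
  rw [htarget, ← hmain, hform]
  -- (8) conclusion
  refine (norm_closedForm_sub_main_le hun.le huR2 hvn hδ hw2' hQa hRa hq₀ hr₀).trans ?_
  have hA : 0 ≤ 2 * ((4 * K₆ + 318) * ε₁) + 2 * 3 * (K₇ * ε₁) := by
    have : (4 * K₆ + 318) * ε₁ = 4 * (K₆ * ε₁) + 318 * ε₁ := by ring
    linarith
  have hA' : 0 ≤ 2 * ((4 * K₆ + 495) * ε₁) + 2 * 2 * (K₇ * ε₁) := by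
    have : (4 * K₆ + 495) * ε₁ = 4 * (K₆ * ε₁) + 495 * ε₁ := by ring
    linarith
  have h4 : 4 * uR * (2 * ((4 * K₆ + 318) * ε₁) + 2 * 3 * (K₇ * ε₁)) ≤
      2 * (2 * ((4 * K₆ + 318) * ε₁) + 2 * 3 * (K₇ * ε₁)) := by
    have := mul_le_mul_of_nonneg_right huR2 hA
    linarith
  have h7 : 7 * uR * (2 * ((4 * K₆ + 495) * ε₁) + 2 * 2 * (K₇ * ε₁)) ≤
      4 * (2 * ((4 * K₆ + 495) * ε₁) + 2 * 2 * (K₇ * ε₁)) := by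
    have := mul_le_mul_of_nonneg_right huR2 hA'
    linarith
  have hexp : (100 * K₆ + 100 * K₇ + 10000) * ε₁ =
      100 * (K₆ * ε₁) + 100 * (K₇ * ε₁) + 10000 * ε₁ := by ring
  have hexp2 : 2 * (2 * ((4 * K₆ + 318) * ε₁) + 2 * 3 * (K₇ * ε₁)) +
      4 * (2 * ((4 * K₆ + 495) * ε₁) + 2 * 2 * (K₇ * ε₁)) + 6 * (10 * ε₁) =
      48 * (K₆ * ε₁) + 28 * (K₇ * ε₁) + 5292 * ε₁ := by ring
  linarith


end Literature.NumberTheory.LFunctions.Zhang2022.Typed.Section15C
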